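import Mathlib
import Summits.Ventures.HodgeRepro.Tier4.Line1.DefinedContentOfData
import Summits.Ventures.HodgeRepro.Tier4.Line4.OrbitProper
import Summits.Ventures.HodgeRepro.Tier4.Line4.HorbInteg
import Summits.Ventures.HodgeRepro.Tier4.Line4.HorbMain
import Summits.Ventures.HodgeRepro.Tier4.Line4.LevelVolume

/-!
# Tier4/Line4/HorbLevel — C-L4-FIBREMAIN: the lower bound of the orbital term with the INTEG displays discharged, and
its UNIFORMITY ALONG THE LEVEL FAMILY `q^n` for the natural witness `finf ⊗ ffinLevel (q^n)`

Blind re-derivation cell `pub-hodge-repro`, Tier 4 «prove the step» (README §9–§10), seat t4-L2-p1 (gen 3; lead (R-28)(c)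
S15087: «the LOWER bound of the fibre sum along `q^n` = C-L4-FIBREMAIN, owner t4-L2-p1 g3»).  Tree path
`lean/Summits/Ventures/HodgeRepro/Tier4/Line4/HorbLevel.lean`.  Imports `Line4/HorbInteg` (p698867: the thirteen INTEG
statements by name), `Line4/HorbMain` (p701801: `norm_orbital_ge_of_chain`), `Line4/LevelVolume` (p702383: `ffinLevel`,
`re_setIntegral_chi_innerFin_ffinLevel_ge` is NOT used — its input `one_le_setIntegral_re_ffinLevel` is), `Line4/OrbitProper`
(p698658: `hasProperFinOrbit_of_isDefinite`), `Line1/DefinedContentOfData` (`isRegularRational_of_isLinRegular`).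
Mathlib-level; no literature.

THE STATEMENTS.  (1) **`norm_orbital_ge_of_integ`** = `norm_orbital_ge_of_chain` with the thirteen integrability /
summability displays discharged by INTEG (IntegFolded p697292 + IntegArch p697545 + IntegProper p698134) from
`Continuous F ∧ HasCompactSupport F`, the product display, PROPER and ZDOMAIN-EX (iv) — exactly `horb_of_integ`'s binders with
`hpos hsupp harch` replaced by `δ` / `hδ`, and the conclusion `c c′ ‖arch‖ · (δ · ∫_{DZ_f × T′_f} Re F_f) ≤ ‖orbital‖`.
(2) **`exists_norm_orbital_ge_ffinLevel`** — THE MAIN TERM OF THE LEVEL FAMILY, UNIFORM IN THE LEVEL: on a definite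
row-genuine plane with a linearly regular `γ₀`, for the product family `F n := finf ⊗ ffinLevel (q^n)` (`finf` a fixed
continuous compactly supported archimedean factor, `q ≠ 0`), if `DZ_f` contains the trace of `K(q^{n₁})` on `T_f` (a strengthened
ZDOMAIN-EX (iii): the compact open subgroup `T_f ∩ K(q^{n₁})` meets `Z(k)` trivially for `n₁` large, so a fundamental domain
containing it exists), `Re (χ(b) conj χ′(b′)) ≥ δ > 0` on the level-`q^{n₁}` support region (FINPOS′ with a margin; the
regions shrink with `n`), and the archimedean factor does not vanish (`harch`, the residual), then
`∃ m > 0, ∀ n ≥ n₁, m ≤ ‖orbital (orbitOf γ₀) (F n)‖` with `m := c c′ ‖arch‖ δ` — the `hmain` input of the TAIL assembly for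
`E = {o₀}` (`Finset.sum_singleton`).  The `T`-normalisation of `ffinLevel` makes the finite factor `≥ δ` with NO volume
input (`one_le_setIntegral_re_ffinLevel`); the `L¹` clause of the same family is `integral_norm_ffinLevel_le_along`
(LevelVolumeAlong p702893) under the one display `LevelVolumeComparisonAlong`.

Nothing here says anything about the status of the Hodge conjecture for CM abelian varieties, which is NOT proved
(HC_CM is NOT proved by anyone in this repository).
-/

set_option autoImplicit false
noncomputable section
namespace Summit.Ventures.HodgeRepro.Tier4.Line4
open Summit.Ventures.HodgeRepro.Tier4 Summit.Ventures.HodgeRepro.Tier4.Common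
  Summit.Ventures.HodgeRepro.Tier4.Line1 MeasureTheory
open scoped ComplexConjugate Topology Pointwise NNReal

section Integ
variable {k : Type} [Field k] [NumberField k] (W : PlaneData k) [MeasurableSpace (GA W)] [BorelSpace (GA W)]
  (R : RTFData W) (μ : Measure (GA W)) [μ.IsHaarMeasure] [R.μT.IsHaarMeasure] [R.μT'.IsHaarMeasure]
  (DG : Set (GA W)) (fdG : IsFundamentalDomain (rationalPoints W) DG μ) (compG : IsCompact (closure DG))
  (compT : IsCompact (closure R.DT)) (compT' : IsCompact (closure R.DT'))

/-- **(1) The lower bound with the INTEG displays discharged**: `horb_of_integ`'s binders with `hpos hsupp harch` replaced by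
the margin `δ` / `hδ`; conclusion `c c′ ‖∫_{T_∞} χ I_∞‖ · (δ · ∫_{DZ_f × T′_f} Re F_f) ≤ ‖orbital (orbitOf γ₀) F‖`. -/
theorem norm_orbital_ge_of_integ [MeasurableMul (torusT W)] [MeasurableMul (torusT' W)]
    [CompactSpace (torusInf W)] [CompactSpace (torusInf' W)] (hR : R.IsHaar)
    (hc : Continuous R.chi) (hu : ∀ a, ‖R.chi a‖ = 1) (hc' : Continuous R.chi') (hu' : ∀ a, ‖R.chi' a‖ = 1)
    (F Finf Ffin : GA W → ℂ) (hF : ∀ g, F g = Finf (GA.ofInfPart W g) * Ffin (GA.ofFinPart W g))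
    (hFc : Continuous F) (hFs : HasCompactSupport F) (hFinfc : Continuous Finf) (hFfinc : Continuous Ffin)
    (Cf : Set (GA W)) (hCf : IsCompact Cf) (hFsupp : ∀ g ∈ finitePart W, Ffin g ≠ 0 → g ∈ Cf)
    (γ₀ : rationalPoints W) (hreg : IsRegularRational W γ₀) (hprop : HasProperFinOrbit W (γ₀ : GA W))
    (νinf : Measure (torusInf W)) [νinf.IsHaarMeasure] (νf : Measure (torusFin W)) [νf.IsHaarMeasure]
    (c : ℝ≥0) (hcμ : R.μT = c • Measure.map (torusSplit W).symm (νinf.prod νf))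
    (νinf' : Measure (torusInf' W)) [νinf'.IsHaarMeasure] (νf' : Measure (torusFin' W)) [νf'.IsHaarMeasure]
    (c' : ℝ≥0) (hcμ' : R.μT' = c' • Measure.map (torusSplit' W).symm (νinf'.prod νf'))
    (DZf : Set (torusFin W)) (hDZf : MeasurableSet DZf) (hfd : IsFundamentalDomain (centreFin W) DZf νf)
    (hDZc : ∀ C : Set (torusFin W), IsCompact C → IsCompact (closure (DZf ∩ (C * (ZfIn W : Set (torusFin W))))))
    (hreal : ∀ g, (Ffin g).im = 0) (hnonneg : ∀ g, 0 ≤ (Ffin g).re) (δ : ℝ)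
    (hδ : ∀ b ∈ DZf, ∀ b' : torusFin' W,
      Ffin ((((b : torusT W) : GA W))⁻¹ * GA.ofFinPart W (γ₀ : GA W) * ((b' : torusT' W) : GA W)) ≠ 0 →
      δ ≤ (R.chi b * conj (R.chi' b')).re) :
    (c : ℝ) * (c' : ℝ) * ‖∫ a : torusInf W, R.chi a * innerInf W R Finf (γ₀ : GA W) νinf' a ∂νinf‖ *
        (δ * ∫ p in DZf ×ˢ Set.univ,
          (Ffin ((((p.1 : torusT W) : GA W))⁻¹ * GA.ofFinPart W (γ₀ : GA W) * ((p.2 : torusT' W) : GA W))).re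
          ∂(νf.prod νf')) ≤
      ‖(Setting.ofAdelicData W R μ DG fdG compG compT compT').orbital R.chi R.chi'
        ((Setting.ofAdelicData W R μ DG fdG compG compT compT').orbitOf γ₀) F‖ := by
  have hint := integrableOn_chi_conj_chi'_Ffin_prod W R hc hu hc' hu' νf νf' Ffin hFfinc Cf hCf hFsupp (γ₀ : GA W) hprop
    DZf hDZf hDZc
  exact norm_orbital_ge_of_chain W R μ DG fdG compG compT compT' hR hc hu hc' hu' F Finf Ffin hF γ₀ hreg νinf νf c hcμ
    νinf' νf' c' hcμ' DZf hDZf hfd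
    (fun γ t => integrable_innerFn_restrict W R hR hc' hu' F hFc hFs (γ : GA W) t)
    (fun t => summable_integral_norm_innerFn_orbit W R hR hc' hu' compT' F hFc hFs γ₀ t)
    (fun γ => integrable_chi_mul_innerInt_restrict W R hR hc hu hc' hu' F hFc hFs (γ : GA W))
    (summable_integral_norm_chi_mul_innerInt_orbit W R hR hc hu hc' hu' compT compT' F hFc hFs γ₀)
    (summable_orbitalc_orbit W R hR hc hu hc' hu' compT compT' F hFc hFs γ₀)
    (integrableOn_chi_mul_innerFull_prodDomain W R hR hc hu hc' hu' F hFc hFs γ₀ hprop DZf hDZf hDZc)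
    (fun s => integrable_innerFn_full W R hR hc' hu' F hFc hFs (γ₀ : GA W) s)
    (fun _ _ => integrable_chi_mul_innerInt_restrict W R hR hc hu hc' hu' F hFc hFs _)
    (fun δ => summable_integral_norm_chi_mul_innerInt_rational W R hR hc hu hc' hu' compT compT' F hFc hFs γ₀ δ)
    (fun t => integrable_conj_chi'_mul_Finf W R hc' hu' νinf' Finf hFinfc (γ₀ : GA W) t)
    (fun t => integrable_conj_chi'_mul_Ffin W R hc' hu' νf' Ffin hFfinc Cf hCf hFsupp (γ₀ : GA W) t)
    (integrable_chi_mul_innerInf W R hc hu hc' hu' νinf νinf' Finf hFinfc (γ₀ : GA W))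
    (integrableOn_chi_mul_innerFin W R hc hu hc' hu' νf νf' Ffin hFfinc Cf hCf hFsupp (γ₀ : GA W) hprop DZf hDZf hDZc)
    hreal hnonneg δ hδ hint

end Integ

/-! ## (2) The level family `finf ⊗ ffinLevel (q^n)` and its main term, uniform in the level -/

section Level
variable {k : Type} [Field k] [NumberField k] (W : PlaneData k) [MeasurableSpace (GA W)] [BorelSpace (GA W)]

/-- **The level family of product test functions** `F n := finf ⊗ ffinLevel (q^n)`: a fixed archimedean factor `finf`
and the natural finite witness at level `q^n`. -/
def levelFamily (νf : Measure (torusFin W)) (νf' : Measure (torusFin' W)) (finf : GA W → ℂ) (γ₀ : GA W) (q n : ℕ)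
    (x : GA W) : ℂ :=
  finf (GA.ofInfPart W x) * ffinLevel W νf νf' γ₀ (q ^ n) (GA.ofFinPart W x)

variable (νf : Measure (torusFin W)) (νf' : Measure (torusFin' W)) (finf : GA W → ℂ) (γ₀ : GA W) (q n : ℕ)

omit [BorelSpace (GA W)] in
/-- The level family is a product test function (`hF` of the chain). -/
theorem levelFamily_apply (x : GA W) :
    levelFamily W νf νf' finf γ₀ q n x = finf (GA.ofInfPart W x) * ffinLevel W νf νf' γ₀ (q ^ n) (GA.ofFinPart W x) :=
  rfl

omit [BorelSpace (GA W)] in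
/-- The level family is continuous (`q ≠ 0`). -/
theorem continuous_levelFamily (hFinfc : Continuous finf) (hq : q ≠ 0) :
    Continuous (levelFamily W νf νf' finf γ₀ q n) :=
  (hFinfc.comp (continuous_ofInfPart W)).mul
    ((continuous_ffinLevel W νf νf' γ₀ (q ^ n) (pow_ne_zero n hq)).comp (continuous_ofFinPart W))

omit [BorelSpace (GA W)] in
/-- The level family has compact support: `supp ⊆ tsupport finf · K(q^n) γ₀,f K(q^n)` (`x = x_∞ x_f`). -/
theorem hasCompactSupport_levelFamily (hFinfs : HasCompactSupport finf) (hq : q ≠ 0) :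
    HasCompactSupport (levelFamily W νf νf' finf γ₀ q n) := by
  refine HasCompactSupport.of_support_subset_isCompact
    (hFinfs.mul (isCompact_levelDoubleCoset W (pow_ne_zero n hq) (GA.ofFinPart W γ₀))) ?_
  intro x hx
  have hx' : finf (GA.ofInfPart W x) * ffinLevel W νf νf' γ₀ (q ^ n) (GA.ofFinPart W x) ≠ 0 := hx
  have h1 : GA.ofInfPart W x ∈ tsupport finf := subset_tsupport finf (left_ne_zero_of_mul hx')
  have h2 : GA.ofFinPart W x ∈ levelDoubleCoset W (q ^ n) (GA.ofFinPart W γ₀) :=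
    mem_levelDoubleCoset_of_ffinLevel_ne_zero W νf νf' γ₀ (q ^ n) (ofFinPart_mem_finitePart W x)
      (right_ne_zero_of_mul hx')
  rw [← GA.ofInfPart_mul_ofFinPart W x]
  exact Set.mul_mem_mul h1 h2

variable (R : RTFData W) (μ : Measure (GA W)) [μ.IsHaarMeasure] [R.μT.IsHaarMeasure] [R.μT'.IsHaarMeasure]
  (DG : Set (GA W)) (fdG : IsFundamentalDomain (rationalPoints W) DG μ) (compG : IsCompact (closure DG))
  (compT : IsCompact (closure R.DT)) (compT' : IsCompact (closure R.DT'))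

/-- **(2) C-L4-FIBREMAIN — the main term of the level family is bounded below UNIFORMLY IN THE LEVEL**: on a definite
row-genuine plane with a linearly regular `γ₀`, for the family `F n := finf ⊗ ffinLevel (q^n)`, if `DZ_f` contains the
trace of `K(q^{n₁})` on `T_f`, `Re (χ(b) conj χ′(b′)) ≥ δ > 0` on the level-`q^{n₁}` support region, and the archimedean
factor does not vanish (`harch`), then `m := c c′ ‖arch‖ δ > 0` satisfies `m ≤ ‖orbital (orbitOf γ₀) (F n)‖` for every
`n ≥ n₁` — the `hmain` input of the TAIL assembly for the fibre `E = {orbitOf γ₀}`. -/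
theorem exists_norm_orbital_ge_levelFamily [MeasurableMul (torusT W)] [MeasurableMul (torusT' W)]
    [CompactSpace (torusInf W)] [CompactSpace (torusInf' W)]
    (hW : Line1.IsDefinite W) (hg : Line1.IsGenuineRow W) (hR : R.IsHaar)
    (hc : Continuous R.chi) (hu : ∀ a, ‖R.chi a‖ = 1) (hc' : Continuous R.chi') (hu' : ∀ a, ‖R.chi' a‖ = 1)
    (finf : GA W → ℂ) (hFinfc : Continuous finf) (hFinfs : HasCompactSupport finf)
    (γ₀ : rationalPoints W) (hreg : Line1.IsLinRegular W γ₀)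
    (νinf : Measure (torusInf W)) [νinf.IsHaarMeasure] (νf : Measure (torusFin W)) [νf.IsHaarMeasure]
    (c : ℝ≥0) (hcμ : R.μT = c • Measure.map (torusSplit W).symm (νinf.prod νf)) (hc0 : c ≠ 0)
    (νinf' : Measure (torusInf' W)) [νinf'.IsHaarMeasure] (νf' : Measure (torusFin' W)) [νf'.IsHaarMeasure]
    (c' : ℝ≥0) (hcμ' : R.μT' = c' • Measure.map (torusSplit' W).symm (νinf'.prod νf')) (hc0' : c' ≠ 0)
    (DZf : Set (torusFin W)) (hDZf : MeasurableSet DZf) (hfd : IsFundamentalDomain (centreFin W) DZf νf)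
    (hDZc : ∀ C : Set (torusFin W), IsCompact C → IsCompact (closure (DZf ∩ (C * (ZfIn W : Set (torusFin W))))))
    (q n₁ : ℕ) (hq : q ≠ 0) (hDZ : levelTf W (q ^ n₁) ⊆ DZf)
    (δ : ℝ) (hδ0 : 0 < δ)
    (hδ : ∀ b ∈ DZf, ∀ b' : torusFin' W,
      (((b : torusT W) : GA W))⁻¹ * GA.ofFinPart W (γ₀ : GA W) * ((b' : torusT' W) : GA W) ∈
        levelDoubleCoset W (q ^ n₁) (GA.ofFinPart W (γ₀ : GA W)) →
      δ ≤ (R.chi b * conj (R.chi' b')).re)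
    (harch : (∫ a : torusInf W, R.chi a * innerInf W R finf (γ₀ : GA W) νinf' a ∂νinf) ≠ 0) :
    ∃ m : ℝ, 0 < m ∧ ∀ n : ℕ, n₁ ≤ n →
      m ≤ ‖(Setting.ofAdelicData W R μ DG fdG compG compT compT').orbital R.chi R.chi'
        ((Setting.ofAdelicData W R μ DG fdG compG compT compT').orbitOf γ₀)
        (levelFamily W νf νf' finf (γ₀ : GA W) q n)‖ := by
  have hcpos : (0 : ℝ) < c := NNReal.coe_pos.2 (pos_iff_ne_zero.2 hc0)
  have hcpos' : (0 : ℝ) < c' := NNReal.coe_pos.2 (pos_iff_ne_zero.2 hc0')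
  have harchpos : 0 < ‖∫ a : torusInf W, R.chi a * innerInf W R finf (γ₀ : GA W) νinf' a ∂νinf‖ :=
    norm_pos_iff.2 harch
  refine ⟨(c : ℝ) * (c' : ℝ) * ‖∫ a : torusInf W, R.chi a * innerInf W R finf (γ₀ : GA W) νinf' a ∂νinf‖ * δ,
    by positivity, fun n hn => ?_⟩
  have hN : q ^ n ≠ 0 := pow_ne_zero n hq
  have hdvd : q ^ n₁ ∣ q ^ n := pow_dvd_pow q hn
  -- the level-`q^n` data shrink into the level-`q^{n₁}` data
  have hDZn : levelTf W (q ^ n) ⊆ DZf := fun b hb => hDZ (levelK_antitone W hdvd hb)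
  have hδn : ∀ b ∈ DZf, ∀ b' : torusFin' W,
      ffinLevel W νf νf' (γ₀ : GA W) (q ^ n)
        ((((b : torusT W) : GA W))⁻¹ * GA.ofFinPart W (γ₀ : GA W) * ((b' : torusT' W) : GA W)) ≠ 0 →
      δ ≤ (R.chi b * conj (R.chi' b')).re := by
    intro b hb b' h0
    refine hδ b hb b' (levelDoubleCoset_antitone W hdvd _ ?_)
    exact mem_levelDoubleCoset_of_ffinLevel_ne_zero W νf νf' (γ₀ : GA W) (q ^ n)
      (orbit_mem_finitePart W (γ₀ : GA W) b b') h0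
  -- PROPER and regularity from the line's own binders
  have hprop : HasProperFinOrbit W (γ₀ : GA W) := hasProperFinOrbit_of_isDefinite W hW hg γ₀ hreg
  have hreg' : IsRegularRational W γ₀ := isRegularRational_of_isLinRegular W γ₀ hreg
  -- the lower bound of the chain for `F n`
  have hmain := norm_orbital_ge_of_integ W R μ DG fdG compG compT compT' hR hc hu hc' hu'
    (levelFamily W νf νf' finf (γ₀ : GA W) q n) finf (ffinLevel W νf νf' (γ₀ : GA W) (q ^ n))
    (fun _ => rfl) (continuous_levelFamily W νf νf' finf (γ₀ : GA W) q n hFinfc hq)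
    (hasCompactSupport_levelFamily W νf νf' finf (γ₀ : GA W) q n hFinfs hq) hFinfc
    (continuous_ffinLevel W νf νf' (γ₀ : GA W) (q ^ n) hN)
    (levelDoubleCoset W (q ^ n) (GA.ofFinPart W (γ₀ : GA W))) (isCompact_levelDoubleCoset W hN _)
    (fun g hg h0 => mem_levelDoubleCoset_of_ffinLevel_ne_zero W νf νf' (γ₀ : GA W) (q ^ n) hg h0)
    γ₀ hreg' hprop νinf νf c hcμ νinf' νf' c' hcμ' DZf hDZf hfd hDZc
    (ffinLevel_im W νf νf' (γ₀ : GA W) (q ^ n)) (ffinLevel_re_nonneg W νf νf' (γ₀ : GA W) (q ^ n) hN) δ hδn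
  -- the finite factor is `≥ 1` (the `T`-normalisation)
  have hint := integrableOn_chi_conj_chi'_Ffin_prod W R hc hu hc' hu' νf νf' (ffinLevel W νf νf' (γ₀ : GA W) (q ^ n))
    (continuous_ffinLevel W νf νf' (γ₀ : GA W) (q ^ n) hN) (levelDoubleCoset W (q ^ n) (GA.ofFinPart W (γ₀ : GA W)))
    (isCompact_levelDoubleCoset W hN _)
    (fun g hg h0 => mem_levelDoubleCoset_of_ffinLevel_ne_zero W νf νf' (γ₀ : GA W) (q ^ n) hg h0)
    (γ₀ : GA W) hprop DZf hDZf hDZc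
  have hge := one_le_setIntegral_re_ffinLevel W νf νf' (γ₀ : GA W) (q ^ n) R hc hu hc' hu' hN DZf hDZn hint
  refine le_trans ?_ hmain
  have h0 : 0 ≤ (c : ℝ) * (c' : ℝ) * ‖∫ a : torusInf W, R.chi a * innerInf W R finf (γ₀ : GA W) νinf' a ∂νinf‖ :=
    by positivity
  refine mul_le_mul_of_nonneg_left ?_ h0
  calc δ = δ * 1 := (mul_one δ).symm
    _ ≤ _ := mul_le_mul_of_nonneg_left hge hδ0.le

end Level

end Summit.Ventures.HodgeRepro.Tier4.Line4

end
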